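import Literature.Geometry.Kaehler.ComplexTorusLefschetzSL2ActionWeightSpaceCharacters
import Literature.LinearAlgebra.DeterminantOfInternalDirectSum
import Literature.Algebra.Lie.LefschetzModuleSL2RepresentationDet
import HarnessLib

/-!
# The circle and Beauville's `SL₂(ℂ)` act on `H•(X; ℂ)` through `SL(H•(X; ℂ))`: `det (e^{iθ})^* = 1` (the Hodge weights balance,
# `Σ_d d · dim ⊕_{p−q=d} H^{p,q} = 0` since `dim W_{−d} = dim W_d`), `det C = 1`, `det((e^{iθ})^* ρ(γ)) = det(C w) = 1`

Layer `Literature/Geometry/Kaehler`, namespace `Literature.Geometry.Kaehler.ComplexTorus`; lane `lit-hodgefound` (Track 2 foundations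
library), prover seat `lit-hodgefound-p09` (generation 54, row g54-#7).  THEOREMS ONLY (no definition, no named fact, no instance, no
notation; D-0026 net debt `0`).  Sequel of rows g54-#3 `ComplexTorusHodgeCircleWeightDecomposition` (`isInternal_weightSpace_Icc`:
`H•(X; ℂ) = ⊕_{d=−g}^{g} W_d`, `weightSpace_eq_bot_of_natAbs_lt`), g54-#5 `…WeightSpaceCharacters` (`rotG_apply_mem_weightSpace`), g54-#6 `LinearAlgebra/DeterminantOfInternalDirectSum`
(**`det_eq_prod_det_restrict`**: `det f = ∏ᵢ det (f|Nᵢ)`), g54-#2 `ComplexTorusWeilOperatorWeylOperator` (`C = rotG E (π/2)`), g53-#11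
`Algebra/Lie/LefschetzModuleSL2RepresentationDet` (`det_sl2Rep`: `det ρ(γ) = 1`, `det_weylOperator`: `det w = 1`) and A1-44
`ComplexTorusKaehlerExteriorModule` (`finrank_weightSpace`: `dim W_{g−j} = C(2g, j)`), all BY NAME.

THE RESULT.  On each weight space `W_d = ⊕_{p−q=d} H^{p,q}(X)` the rotation `(e^{iθ})^*` is the scalar `e^{idθ}`, so `det (e^{iθ})^* =
∏_d e^{idθ dim W_d} = exp(iθ Σ_d d · dim W_d)`; Hodge symmetry `dim W_{−d} = dim W_d` (`= C(2g, g−d) = C(2g, g+d)`) kills the exponent: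
the first moment of the Hodge weights `Σ_{p,q} (p − q) h^{p,q}(X)` vanishes.  Hence the circle of the complex structure — in particular the Weil
operator `C = (i·)^*` — acts on `H•(X; ℂ)` with determinant `1` (Deligne: `h(U¹)` and `C = h(i)` lie in the group of the polarised Hodge
structure, which is special), as does Beauville's `ρ(SL₂(ℂ))` (g53-#11), so `det((e^{iθ})^* ρ(γ)) = det(C w) = 1`.

## What is proved (`W_d = weightSpace E d`, `g = dim_ℂ E ≥ 1`)

* §1 `finrank_weightSpace_of_natAbs_le` (`dim W_d = C(2g, (g − d))` for `|d| ≤ g`), **`finrank_weightSpace_neg`** (`dim W_{−d} = dim W_d`),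
  **`sum_Icc_mul_finrank_weightSpace_eq_zero`** (`Σ_{d=−g}^{g} d · dim W_d = 0`: the Hodge weights balance).
* §2 `restrict_rotG_weightSpace_eq_smul` (`(e^{iθ})^*|W_d = e^{idθ} · 1`), `det_restrict_rotG_weightSpace` (`= e^{idθ · dim W_d}`),
  **`det_rotG`** (`det (e^{iθ})^* = 1`), **`det_rotG_pi_div_two`** (`det C = 1`).
* §3 with a non-degenerate real `2`-form `η`: `det_rotG_mul_sl2Rep` (`det((e^{iθ})^* ρ(γ)) = 1`), `det_rotG_pi_div_two_mul_weylOperator`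
  (`det(C w) = 1`).

## Sources, VERBATIM

* P. Deligne (notes by J. Milne), *Hodge cycles on abelian varieties*, LNM 900 (1982) [Deligne1982HodgeCycles], I §1: "`h(z) v^{p,q} =
  z^{−p} z̄^{−q} v^{p,q}`", "the hodge filtration … `h^{p,q} = h^{q,p}`" (Hodge symmetry `V^{q,p} = V̄^{p,q}`); I Prop. 3.6 (proof): "write
  `C = h(i)` […] Since `C = h(i)` acts as `i ī = 1` on `ℚ(1)`, `C ∈ G⁰(ℝ)`" (the Weil operator lies in the special Mumford–Tate group).
* H. Lange, *Abelian Varieties over the Complex Numbers* (2023) [Lange2023AbelianVarietiesComplex], §1.1.5 Thm. 1.1.21 and Prop. 1.1.23: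
  "`H^q(Ω^p_X) ≃ ⋀ᵖΩ ⊗ ⋀^qΩ̄`", `h^{p,q} = h^{q,p} = C(g,p)C(g,q)`; §7.2.1 (p. 329): "`h(S¹) ⊆ Hg(X)(ℝ)`" with `Hg(X) ⊆ SL(V)`.
* R. A. Horn, C. R. Johnson, *Matrix Analysis* (2013) [HornJohnson2013], §0.9.2: "`det (⊕ᵢ A_{ii}) = ∏ᵢ det A_{ii}`".
* A. Beauville, *The action of SL₂ on abelian varieties* (2010) [Beauville2010SL2], §3–§4 (the representation of `SL₂`; `h = (0 −1 ; 1 0)`).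

## Scope

Forms carrier `H•(X; ℂ)` only; the statement `h(S¹) ⊆ Hg(X)(ℝ) ⊆ Sp(V)` on `V = H₁` itself is the tree's `hodgeCircleSL_mem_hodgeGroup` and is
not restated.  No lattice or polarisation is needed in §1–§2.
-/

noncomputable section

-- `Module ℂ` / `SMulZeroClass ℂ` synthesis on `E [⋀^Fin k]→L[ℝ] ℂ` (as in `ComplexTorusLefschetzDecomposition`)
set_option maxSynthPendingDepth 3

namespace Literature.Geometry.Kaehler

namespace ComplexTorus

-- `_root_.Complex`: the import closure declares a namespace `…ComplexTorus.Complex`; be explicit.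
open Module Function Finset _root_.Complex
open scoped MatrixGroups Real
open Literature.LinearAlgebra Literature.LinearAlgebra.Alternating Literature.Algebra.Lie Literature.Analysis.Complex

universe uE

variable {E : Type uE} [NormedAddCommGroup E] [NormedSpace ℂ E] [FiniteDimensional ℂ E] [Nontrivial E] {η : E [⋀^Fin 2]→L[ℝ] ℝ}

/-! ## §1 Hodge symmetry of the weight dimensions and the balance `Σ_d d · dim W_d = 0` -/

section Symmetry

omit [Nontrivial E] in
/-- **`dim ⊕_{p−q=d} H^{p,q}(X) = C(2g, g − d)`** for `|d| ≤ g` (the tree's `finrank_weightSpace`, re-indexed by the weight).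
[cite: Lange2023AbelianVarietiesComplex, §1.1.5 Prop. 1.1.23] [cite: Deligne1982HodgeCycles, I §1] -/
theorem finrank_weightSpace_of_natAbs_le {d : ℤ} (hd : d.natAbs ≤ finrank ℂ E) :
    finrank ℂ ↥(weightSpace E d) = (2 * finrank ℂ E).choose ((finrank ℂ E : ℤ) - d).toNat := by
  have h : d = (finrank ℂ E : ℤ) - ((((finrank ℂ E : ℤ) - d).toNat : ℕ) : ℤ) := by omega
  conv_lhs => rw [h]
  exact finrank_weightSpace _

omit [Nontrivial E] in
/-- **Hodge symmetry of the weights: `dim ⊕_{p−q=−d} H^{p,q}(X) = dim ⊕_{p−q=d} H^{p,q}(X)`** (`h^{q,p} = h^{p,q}`; `C(2g, g+d) = C(2g, g−d)`;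
both sides vanish for `|d| > g`). [cite: Deligne1982HodgeCycles, I §1 ("h^{p,q} = h^{q,p}")] [cite: Lange2023AbelianVarietiesComplex, §1.1.5 Prop. 1.1.23] -/
theorem finrank_weightSpace_neg (d : ℤ) : finrank ℂ ↥(weightSpace E (-d)) = finrank ℂ ↥(weightSpace E d) := by
  by_cases hd : d.natAbs ≤ finrank ℂ E
  · rw [finrank_weightSpace_of_natAbs_le hd, finrank_weightSpace_of_natAbs_le (d := -d) (by omega),
      ← Nat.choose_symm (by omega)]
    congr 1
    omega
  · rw [weightSpace_eq_bot_of_natAbs_lt (not_le.1 hd), weightSpace_eq_bot_of_natAbs_lt (d := -d) (by omega)]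

omit [Nontrivial E] in
/-- **`Σ_{d=−g}^{g} d · dim ⊕_{p−q=d} H^{p,q}(X) = 0`**: the Hodge weights balance (`Σ_{p,q} (p − q) h^{p,q} = 0` by `h^{p,q} = h^{q,p}`; the
sum is its own negative under `d ↦ −d`). [cite: Deligne1982HodgeCycles, I §1 ("h^{p,q} = h^{q,p}")] [cite: Lange2023AbelianVarietiesComplex, §1.1.5 Prop. 1.1.23] -/
theorem sum_Icc_mul_finrank_weightSpace_eq_zero :
    ∑ d ∈ Finset.Icc (-(finrank ℂ E : ℤ)) (finrank ℂ E : ℤ), d * (finrank ℂ ↥(weightSpace E d) : ℤ) = 0 := by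
  set g : ℤ := (finrank ℂ E : ℤ) with hg
  have h : ∑ d ∈ Finset.Icc (-g) g, d * (finrank ℂ ↥(weightSpace E d) : ℤ) =
      ∑ d ∈ Finset.Icc (-g) g, (-d) * (finrank ℂ ↥(weightSpace E d) : ℤ) := by
    refine Finset.sum_nbij' (fun d ↦ -d) (fun d ↦ -d) (fun d hd ↦ ?_) (fun d hd ↦ ?_) (fun d _ ↦ neg_neg d) (fun d _ ↦ neg_neg d)
      fun d _ ↦ ?_
    · rw [Finset.mem_Icc] at hd ⊢; omega
    · rw [Finset.mem_Icc] at hd ⊢; omega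
    · rw [neg_neg, finrank_weightSpace_neg]
  rw [Finset.sum_congr rfl fun d _ ↦ neg_mul d (finrank ℂ ↥(weightSpace E d) : ℤ), Finset.sum_neg_distrib] at h
  linarith

end Symmetry

/-! ## §2 `det (e^{iθ})^* = 1` and `det C = 1` -/

section Det

omit [FiniteDimensional ℂ E] [Nontrivial E] in
/-- **`(e^{iθ})^* | ⊕_{p−q=d} H^{p,q} = e^{idθ} · 1`.** [cite: Deligne1982HodgeCycles, I §1 ("h(z) v^{p,q} = z^{−p} z̄^{−q} v^{p,q}")] -/
theorem restrict_rotG_weightSpace_eq_smul (θ : ℝ) (d : ℤ) :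
    (rotG E θ).restrict (fun _ hx ↦ rotG_apply_mem_weightSpace θ (d := d) hx) = cexp (d * θ * I) • LinearMap.id :=
  LinearMap.ext fun x ↦ Subtype.ext (by
    rw [LinearMap.coe_restrict_apply, LinearMap.smul_apply, LinearMap.id_apply, Submodule.coe_smul, x.2 θ])

omit [Nontrivial E] in
/-- **`det((e^{iθ})^* | ⊕_{p−q=d} H^{p,q}) = e^{idθ · dim W_d}`.** [cite: Deligne1982HodgeCycles, I §1] [cite: HornJohnson2013, §0.9.2] -/
theorem det_restrict_rotG_weightSpace (θ : ℝ) (d : ℤ) :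
    LinearMap.det ((rotG E θ).restrict (fun _ hx ↦ rotG_apply_mem_weightSpace θ (d := d) hx)) = cexp (d * θ * I) ^ finrank ℂ ↥(weightSpace E d) := by
  rw [restrict_rotG_weightSpace_eq_smul, LinearMap.det_smul, LinearMap.det_id, mul_one]

omit [Nontrivial E] in
/-- **`det (e^{iθ})^* = 1` on `H•(X; ℂ)`**: `∏_{d=−g}^{g} e^{idθ dim W_d} = exp(iθ Σ_d d · dim W_d) = e⁰` — the circle of the complex structure acts
through `SL(H•(X; ℂ))`. [cite: Deligne1982HodgeCycles, I §1 and I Prop. 3.6 (proof, "C ∈ G⁰(ℝ)")] [cite: Lange2023AbelianVarietiesComplex, §7.2.1 (p. 329)]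
[cite: HornJohnson2013, §0.9.2] -/
theorem det_rotG (θ : ℝ) : LinearMap.det (rotG E θ) = 1 := by
  rw [det_eq_prod_det_restrict isInternal_weightSpace_Icc (f := rotG E θ) fun d _ hx ↦ rotG_apply_mem_weightSpace θ (d := (d : ℤ)) hx,
    Finset.prod_coe_sort (Finset.Icc (-(finrank ℂ E : ℤ)) (finrank ℂ E : ℤ))
      (fun d : ℤ ↦ LinearMap.det ((rotG E θ).restrict (fun _ hx ↦ rotG_apply_mem_weightSpace θ (d := d) hx))),
    Finset.prod_congr rfl fun d _ ↦ (det_restrict_rotG_weightSpace θ d).trans (Complex.exp_nat_mul _ _).symm, ← Complex.exp_sum,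
    Finset.sum_congr rfl fun d _ ↦ show (finrank ℂ ↥(weightSpace E d) : ℂ) * (d * θ * I) = ((d * (finrank ℂ ↥(weightSpace E d) : ℤ) : ℤ) : ℂ) *
      (θ * I) by push_cast; ring, ← Finset.sum_mul, ← Int.cast_sum, sum_Icc_mul_finrank_weightSpace_eq_zero, Int.cast_zero, zero_mul,
    Complex.exp_zero]

omit [Nontrivial E] in
/-- **`det C = 1`** for the Weil operator `C = (i·)^* = Σ i^{p−q} π^{p,q}` on `H•(X; ℂ)` (`∏ i^{(p−q)h^{p,q}} = 1`; "`C ∈ G⁰(ℝ)`", the special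
Mumford–Tate group). [cite: Deligne1982HodgeCycles, I Prop. 3.6 (proof)] -/
theorem det_rotG_pi_div_two : LinearMap.det (rotG E (π / 2)) = 1 := det_rotG _

omit [Nontrivial E] in
/-- The rotations are invertible with determinant-`1` inverse: `det (e^{−iθ})^* = 1`. [cite: Deligne1982HodgeCycles, I §1] -/
theorem det_rotG_neg (θ : ℝ) : LinearMap.det (rotG E (-θ)) = 1 := det_rotG _

end Det

/-! ## §3 Together with `ρ(SL₂(ℂ)) ⊆ SL(H•(X; ℂ))` -/

section WithSL2

/-- **`det((e^{iθ})^* ∘ ρ(γ)) = 1`**: the whole of `U(1) · ρ(SL₂(ℂ))` acts on `H•(X; ℂ)` through `SL` (g53-#11 `det ρ(γ) = 1`).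
[cite: Deligne1982HodgeCycles, I §1 and Prop. 3.6 (proof)] [cite: Beauville2010SL2, §4 Theorem] -/
theorem det_rotG_mul_sl2Rep (hη : ∀ v : E, v ≠ 0 → ∃ w : E, η ![v, w] ≠ 0) (θ : ℝ) (γ : SL(2, ℂ)) :
    LinearMap.det (rotG E θ * (hasLefschetzProperty_lefschetzG hη).sl2Rep isZGrading_countingG γ) = 1 := by
  rw [map_mul, det_rotG, (hasLefschetzProperty_lefschetzG hη).det_sl2Rep isZGrading_countingG γ, mul_one]

/-- **`det(C w) = 1`** for the Weil operator `C` and the Weyl operator `w` (`det C = det w = 1`). [cite: Deligne1982HodgeCycles, I Prop. 3.6 (proof)]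
[cite: Beauville2010SL2, §3 Proposition ("h = (0 −1 ; 1 0)")] -/
theorem det_rotG_pi_div_two_mul_weylOperator (hη : ∀ v : E, v ≠ 0 → ∃ w : E, η ![v, w] ≠ 0) :
    LinearMap.det (rotG E (π / 2) * (hasLefschetzProperty_lefschetzG hη).weylOperator isZGrading_countingG) = 1 := by
  rw [map_mul, det_rotG_pi_div_two, (hasLefschetzProperty_lefschetzG hη).det_weylOperator isZGrading_countingG, mul_one]

end WithSL2

end ComplexTorus

end Literature.Geometry.Kaehler

end
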